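import Mathlib
import Summits.NavierStokesRegularity.NavierStokesRegularity.Theorems.FilamentSkeletonRssSkeletonJ1RLiaReference
import Summits.NavierStokesRegularity.NavierStokesRegularity.Theorems.FilamentSkeletonRssSkeletonJ1RLiaBootstrap
import Summits.NavierStokesRegularity.NavierStokesRegularity.Theorems.FilamentSkeletonRssSkeletonJ1RLiaGeometry

/-!
# Route `FilamentSkeletonRss` · crux `SkeletonJ1R` (stmt-NavierStokesRegularity-23610) · registered line `streamline_kantorovich_R`
# — brick F(i)-e for stub F1 `LiaFrameExistsL`: the LIA reference is a SLICED REFERENCE (tilt `≤ Rb/8`, curvature `√Γ‖x″‖ ≤ Rb/2`, separation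
# `(ρ/2)√Γ`) under EXPLICIT smallness hypotheses on two datum-dependent rates

Lead `ns-fsr-lead-23610` (g0), `--supports stmt-NavierStokesRegularity-23610 --as helper`.  Assembles the Γ-free bricks `…LiaShooting` (p712316),
`…LiaBootstrap`, `…LiaGeometry` and the instantiation `…LiaReference` into the admissibility of the LIA reference, keeping the two Γ-dependent
rates ABSTRACT: for filament `j` let
  `κ_j = |β_j⁻¹| · ( Σ_{k ≠ j} |Γγ_k/4π| · (2/((ρ/2)√Γ)) + (½ + |α|) · R )`,  `R = √3 · |Rb √(Γ log Γ)|`  (in-ball curvature ceiling),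
  `τ_j = 2 (R + ‖√Γ q_j‖) + 1`  (exit length of a near-straight arc), `q_j = p_j + s₀_j t_j` the datum waist.
THEOREMS (datum: unit directions, general position `θd ∈ (0,1]`, separation `ρ > 0`; a tilt budget `θ₁` with `Rb/8 < θ₁ ≤ ½` and
`θ₁ ≤ min (√θd/4) (θd ρ/(16(‖q_j − q_k‖ + ρ)))` for all `j ≠ k`):
* `IsLiaReference.curvature_le_of_tiltOn` (+ `_neg`) — on `[0,T]` (resp. `[−T,0]`), tilt `≤ θ₁` ⇒ curvature `≤ κ_j` (partner lines stay at
  distance `≥ (ρ/2)√Γ`: `dist_partner_ge_of_nearStraightOn`; `norm_ambientField_le`; flat outside radius `R`);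
* `IsLiaReference.tilt_le` — if `κ_j τ_j ≤ Rb/8` then `‖x_j′ τ − t_j‖ ≤ Rb/8` for ALL `τ` (bootstrap, both half-lines);
* `IsLiaReference.curvature_sqrt_le` — if moreover `κ_j √Γ ≤ Rb/2` then `‖x_j″ τ‖ √Γ ≤ Rb/2` for all `τ`;
* `IsLiaReference.separation` — the references of `j ≠ k` stay `(ρ/2)√Γ` apart (skew divergence of the datum lines beats the `Rb/8` tilt);
* `IsLiaReference.slicedReference` — hence `SlicedReference Γ ρ Rb p t s₀ x` under the two rate hypotheses for every `j`.
The choice of `Rb₁(datum)` and `Γ₁(datum, Rb)` making the rate hypotheses true (`κ_j τ_j → 48π(½+|α|)Rb²/|γ_j|`, `κ_j√Γ → 0` as `Γ → ∞`) is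
the last brick of F1, together with the sliced model.

HONEST FRAMING.  Bookkeeping for the ∃-side of a HYPOTHETICAL filament-type rotating-self-similar blow-up skeleton (MODEL rung, negative side);
nothing here is a claim about Navier–Stokes regularity or blow-up; stub F1 and the crux stay OPEN.
-/

set_option linter.dupNamespace false -- `NavierStokesRegularity.NavierStokesRegularity` path/namespace repetition is the tree convention

noncomputable section

namespace Summit.NavierStokesRegularity.NavierStokesRegularity.Theorems.SkeletonJ1RFrame

open Set Function Filter Real Topology
open Literature.Analysis.FluidPDE
open scoped InnerProductSpace BigOperators

/-! ## §0 Datum bookkeeping -/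

/-- The datum waist of line `j` (unscaled): `q_j = p_j + s₀_j t_j`; `waistPt Γ p t s₀ j = √Γ • q_j`. [folklore] -/
theorem waistPt_eq {N : ℕ} (Γ : ℝ) (p t : Fin N → EuclideanSpace ℝ (Fin 3)) (s₀ : Fin N → ℝ) (j : Fin N) :
    waistPt Γ p t s₀ j = Real.sqrt Γ • (p j + s₀ j • t j) := rfl

/-- Separation of the datum lines in waist-based parametrisation: `ρ ≤ ‖(q_j + a t_j) − (q_k + b t_k)‖` for all `a, b`. [folklore] -/
theorem datum_sep_waist {N : ℕ} {ρ : ℝ} {p t : Fin N → EuclideanSpace ℝ (Fin 3)} {s₀ : Fin N → ℝ}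
    (hsep : ∀ j k, j ≠ k → ∀ a b : ℝ, ρ ≤ ‖(p j + a • t j) - (p k + b • t k)‖) {j k : Fin N} (hjk : j ≠ k) (a b : ℝ) :
    ρ ≤ ‖(p j + s₀ j • t j + a • t j) - (p k + s₀ k • t k + b • t k)‖ := by
  have h := hsep j k hjk (s₀ j + a) (s₀ k + b)
  rwa [add_smul, add_smul, ← add_assoc, ← add_assoc] at h

/-- `√θd/4 ≤ √(θd/2)/2`: the separation tilt budget is below the partner-distance tilt budget. [folklore] -/
theorem sqrt_quarter_le_sqrt_half_half (θd : ℝ) : Real.sqrt θd / 4 ≤ Real.sqrt (θd / 2) / 2 := by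
  rw [Real.sqrt_div' θd (by norm_num : (0:ℝ) ≤ 2), div_div]
  have h2 : Real.sqrt 2 * 2 ≤ 4 := by nlinarith [Real.sq_sqrt (show (0:ℝ) ≤ 2 by norm_num), Real.sqrt_nonneg 2]
  exact div_le_div_of_nonneg_left (Real.sqrt_nonneg _) (by positivity) h2

variable {N : ℕ} {Γ Rb ρ θd : ℝ} {p t : Fin N → EuclideanSpace ℝ (Fin 3)} {γ : Fin N → ℝ} {α : ℝ} {s₀ : Fin N → ℝ}
  {x : Fin N → ℝ → EuclideanSpace ℝ (Fin 3)}

/-- The in-ball curvature ceiling of filament `j` (see the module docstring). [folklore] -/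
def curvCeil (Γ Rb ρ : ℝ) (γ : Fin N → ℝ) (α : ℝ) (j : Fin N) : ℝ :=
  |(liaCoeff Γ γ j)⁻¹| * ((∑ k ∈ Finset.univ.erase j, |Γ*γ k/(4*Real.pi)| * (2 / (ρ / 2 * Real.sqrt Γ))) +
    (1/2 + |α|) * (Real.sqrt 3 * |Rb * Real.sqrt (Γ * Real.log Γ)|))

/-- `0 ≤ curvCeil` when `0 < ρ√Γ`... in fact for `0 ≤ ρ` and any `Γ` (all summands are nonnegative). [folklore] -/
theorem curvCeil_nonneg (hρ : 0 ≤ ρ) (j : Fin N) : 0 ≤ curvCeil Γ Rb ρ γ α j := by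
  unfold curvCeil
  refine mul_nonneg (abs_nonneg _) (add_nonneg (Finset.sum_nonneg fun k _ => mul_nonneg (abs_nonneg _) ?_) (by positivity))
  have : 0 ≤ ρ / 2 * Real.sqrt Γ := by positivity
  positivity

/-! ## §1 Conditional curvature bound on a forward window -/

/-- **Conditional curvature bound (forward).**  Datum: unit directions, general position `θd ∈ (0,1]`, separation `ρ > 0`; `Γ > 0`; tilt budget
`0 ≤ θ₁ ≤ min (√θd/4) (θd ρ/(16(‖q_j − q_k‖ + ρ)))` for all `k ≠ j`.  If the LIA reference `x_j` has tilt `≤ θ₁` on `[0, T]` then its curvature is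
`≤ curvCeil` on `[0, T]`. [folklore] -/
theorem IsLiaReference.curvature_le_of_tiltOn (hx : IsLiaReference Γ Rb p t γ α s₀ x) (ht : ∀ k, ‖t k‖ = 1) (hθd : 0 < θd) (hθd1 : θd ≤ 1)
    (hgp : ∀ j k, j ≠ k → |inner ℝ (t j) (t k)| ≤ 1 - θd) (hρ : 0 < ρ)
    (hsep : ∀ j k, j ≠ k → ∀ a b : ℝ, ρ ≤ ‖(p j + a • t j) - (p k + b • t k)‖) (hΓ : 0 < Γ) (hℓ : Rb * Real.sqrt (Γ * Real.log Γ) ≠ 0) (j : Fin N) {θ₁ : ℝ} (hθ₁0 : 0 ≤ θ₁)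
    (hθ₁A : ∀ k, k ≠ j → θ₁ ≤ min (Real.sqrt θd / 4) (θd * ρ / (16 * (‖(p j + s₀ j • t j) - (p k + s₀ k • t k)‖ + ρ))))
    {T : ℝ} (htilt : ∀ σ ∈ Icc 0 T, ‖deriv (x j) σ - t j‖ ≤ θ₁) :
    ∀ σ ∈ Icc 0 T, ‖iteratedDeriv 2 (x j) σ‖ ≤ curvCeil Γ Rb ρ γ α j := by
  intro σ hσ
  obtain ⟨hC2, hunit, h0, h0', hode⟩ := hx j
  set R := Real.sqrt 3 * |Rb * Real.sqrt (Γ * Real.log Γ)| with hR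
  by_cases hin : ‖x j σ‖ ≤ R
  · -- inside: curvature law + ambient bound from partner distance
    have hd : 0 < ρ / 2 * Real.sqrt Γ := by have := Real.sqrt_pos.2 hΓ; positivity
    have hfar : ∀ k, k ≠ j → (ρ / 2 * Real.sqrt Γ) ^ 2 ≤
        ‖x j σ - waistPt Γ p t s₀ k‖ ^ 2 - (inner ℝ (x j σ - waistPt Γ p t s₀ k) (t k)) ^ 2 := by
      intro k hk
      rw [waistPt_eq]
      have hA := hθ₁A k hk
      refine dist_partner_ge_of_nearStraightOn (hC2.of_le (by norm_num)) (ht j) (ht k) hθd hθd1 (hgp j k hk.symm) hρ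
        (fun a b => datum_sep_waist hsep hk.symm a b) (by rw [h0, waistPt_eq]) hθ₁0
        ((le_min_iff.1 hA).1.trans (sqrt_quarter_le_sqrt_half_half θd)) (le_min_iff.1 hA).2 htilt hσ
    have hW := norm_ambientField_le Γ p t γ α s₀ ht j (x j σ) hd hfar
    have hκ := hx.norm_iteratedDeriv_two_le j σ
    unfold curvCeil
    refine hκ.trans (mul_le_mul_of_nonneg_left (hW.trans (add_le_add le_rfl ?_)) (abs_nonneg _))
    exact mul_le_mul_of_nonneg_left hin (by positivity)
  · -- outside: flat
    push Not at hin
    have hfar : 3 * (Rb * Real.sqrt (Γ * Real.log Γ)) ^ 2 ≤ ‖x j σ‖ ^ 2 := by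
      have h3 : R ^ 2 = 3 * (Rb * Real.sqrt (Γ * Real.log Γ)) ^ 2 := by
        rw [hR, mul_pow, sq_abs, Real.sq_sqrt (by norm_num : (0:ℝ) ≤ 3)]
      rw [← h3]
      have hR0 : 0 ≤ R := by positivity
      exact pow_le_pow_left₀ hR0 hin.le 2
    rw [hx.iteratedDeriv_two_eq_zero hℓ j hfar, norm_zero]
    exact curvCeil_nonneg hρ.le j

/-- **Conditional curvature bound (backward)**: the same on `[−T, 0]`, by reversing the arc (`σ ↦ x_j(−σ)` is near-straight along `−t_j`; the
partner lines and the general-position / separation data are reversal-invariant). [folklore] -/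
theorem IsLiaReference.curvature_le_of_tiltOn_neg (hx : IsLiaReference Γ Rb p t γ α s₀ x) (ht : ∀ k, ‖t k‖ = 1) (hθd : 0 < θd)
    (hθd1 : θd ≤ 1) (hgp : ∀ j k, j ≠ k → |inner ℝ (t j) (t k)| ≤ 1 - θd) (hρ : 0 < ρ)
    (hsep : ∀ j k, j ≠ k → ∀ a b : ℝ, ρ ≤ ‖(p j + a • t j) - (p k + b • t k)‖) (hΓ : 0 < Γ) (hℓ : Rb * Real.sqrt (Γ * Real.log Γ) ≠ 0) (j : Fin N) {θ₁ : ℝ} (hθ₁0 : 0 ≤ θ₁)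
    (hθ₁A : ∀ k, k ≠ j → θ₁ ≤ min (Real.sqrt θd / 4) (θd * ρ / (16 * (‖(p j + s₀ j • t j) - (p k + s₀ k • t k)‖ + ρ))))
    {T : ℝ} (htilt : ∀ σ ∈ Icc (-T) 0, ‖deriv (x j) σ - t j‖ ≤ θ₁) :
    ∀ σ ∈ Icc (-T) 0, ‖iteratedDeriv 2 (x j) σ‖ ≤ curvCeil Γ Rb ρ γ α j := by
  intro σ hσ
  obtain ⟨hC2, hunit, h0, h0', hode⟩ := hx j
  set R := Real.sqrt 3 * |Rb * Real.sqrt (Γ * Real.log Γ)| with hR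
  by_cases hin : ‖x j σ‖ ≤ R
  · have hd : 0 < ρ / 2 * Real.sqrt Γ := by have := Real.sqrt_pos.2 hΓ; positivity
    -- reversed arc
    set y : ℝ → EuclideanSpace ℝ (Fin 3) := fun s => x j (-s) with hy
    have hyC : ContDiff ℝ 1 y := (hC2.of_le (by norm_num)).comp contDiff_neg
    have hyd : ∀ s, deriv y s = -deriv (x j) (-s) := fun s => by rw [hy]; exact deriv_comp_neg (f := x j) (x := s)
    have hytilt : ∀ s ∈ Icc 0 T, ‖deriv y s - -t j‖ ≤ θ₁ := by
      intro s hs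
      rw [hyd, show -deriv (x j) (-s) - -t j = -(deriv (x j) (-s) - t j) by abel, norm_neg]
      exact htilt (-s) ⟨by linarith [hs.2], by linarith [hs.1]⟩
    have hfar : ∀ k, k ≠ j → (ρ / 2 * Real.sqrt Γ) ^ 2 ≤
        ‖x j σ - waistPt Γ p t s₀ k‖ ^ 2 - (inner ℝ (x j σ - waistPt Γ p t s₀ k) (t k)) ^ 2 := by
      intro k hk
      rw [waistPt_eq]
      have hA := hθ₁A k hk
      have hnt : ‖-t j‖ = 1 := by rw [norm_neg, ht j]
      have hgp' : |inner ℝ (-t j) (t k)| ≤ 1 - θd := by rw [inner_neg_left, abs_neg]; exact hgp j k hk.symm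
      have hsep' : ∀ a b : ℝ, ρ ≤ ‖(p j + s₀ j • t j + a • -t j) - (p k + s₀ k • t k + b • t k)‖ := by
        intro a b
        have h := datum_sep_waist (s₀ := s₀) hsep hk.symm (-a) b
        rwa [neg_smul, ← smul_neg] at h
      have h := dist_partner_ge_of_nearStraightOn hyC hnt (ht k) hθd hθd1 hgp' hρ hsep'
        (by simp only [hy, neg_zero]; rw [h0, waistPt_eq]) hθ₁0
        ((le_min_iff.1 hA).1.trans (sqrt_quarter_le_sqrt_half_half θd)) (le_min_iff.1 hA).2 hytilt
        (τ := -σ) ⟨by linarith [hσ.2], by linarith [hσ.1]⟩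
      simpa only [hy, neg_neg] using h
    have hW := norm_ambientField_le Γ p t γ α s₀ ht j (x j σ) hd hfar
    have hκ := hx.norm_iteratedDeriv_two_le j σ
    unfold curvCeil
    refine hκ.trans (mul_le_mul_of_nonneg_left (hW.trans (add_le_add le_rfl ?_)) (abs_nonneg _))
    exact mul_le_mul_of_nonneg_left hin (by positivity)
  · push Not at hin
    have hfar : 3 * (Rb * Real.sqrt (Γ * Real.log Γ)) ^ 2 ≤ ‖x j σ‖ ^ 2 := by
      have h3 : R ^ 2 = 3 * (Rb * Real.sqrt (Γ * Real.log Γ)) ^ 2 := by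
        rw [hR, mul_pow, sq_abs, Real.sq_sqrt (by norm_num : (0:ℝ) ≤ 3)]
      rw [← h3]
      have hR0 : 0 ≤ R := by positivity
      exact pow_le_pow_left₀ hR0 hin.le 2
    rw [hx.iteratedDeriv_two_eq_zero hℓ j hfar, norm_zero]
    exact curvCeil_nonneg hρ.le j

/-! ## §2 Global tilt and curvature of the reference -/

/-- **TILT OF THE LIA REFERENCE.**  Under the datum hypotheses of §1, a tilt budget `Rb/8 < θ₁ ≤ ½` (with the bounds of §1) and the rate hypothesis
`curvCeil · (2(R + ‖√Γ q_j‖) + 1) ≤ Rb/8`, the reference has tilt `‖x_j′ τ − t_j‖ ≤ Rb/8` for ALL `τ`. [folklore] -/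
theorem IsLiaReference.tilt_le (hx : IsLiaReference Γ Rb p t γ α s₀ x) (ht : ∀ k, ‖t k‖ = 1) (hθd : 0 < θd) (hθd1 : θd ≤ 1)
    (hgp : ∀ j k, j ≠ k → |inner ℝ (t j) (t k)| ≤ 1 - θd) (hρ : 0 < ρ)
    (hsep : ∀ j k, j ≠ k → ∀ a b : ℝ, ρ ≤ ‖(p j + a • t j) - (p k + b • t k)‖) (hΓ : 0 < Γ) (hℓ : Rb * Real.sqrt (Γ * Real.log Γ) ≠ 0) (j : Fin N) {θ₁ : ℝ}
    (hRbθ : Rb / 8 < θ₁) (hθ₁h : θ₁ ≤ 1 / 2)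
    (hθ₁A : ∀ k, k ≠ j → θ₁ ≤ min (Real.sqrt θd / 4) (θd * ρ / (16 * (‖(p j + s₀ j • t j) - (p k + s₀ k • t k)‖ + ρ))))
    (hrate : curvCeil Γ Rb ρ γ α j * (2 * (Real.sqrt 3 * |Rb * Real.sqrt (Γ * Real.log Γ)| + ‖waistPt Γ p t s₀ j‖) + 1) ≤ Rb / 8) :
    ∀ τ, ‖deriv (x j) τ - t j‖ ≤ Rb / 8 := by
  obtain ⟨hC2, hunit, h0, h0', hode⟩ := hx j
  have hκ0 : 0 ≤ curvCeil Γ Rb ρ γ α j := curvCeil_nonneg hρ.le j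
  have hR0 : 0 ≤ Real.sqrt 3 * |Rb * Real.sqrt (Γ * Real.log Γ)| := by positivity
  have hθ₁0 : 0 ≤ θ₁ := by
    have : 0 ≤ curvCeil Γ Rb ρ γ α j * (2 * (Real.sqrt 3 * |Rb * Real.sqrt (Γ * Real.log Γ)| + ‖waistPt Γ p t s₀ j‖) + 1) := by
      positivity
    linarith
  have hrate' : curvCeil Γ Rb ρ γ α j * (2 * (Real.sqrt 3 * |Rb * Real.sqrt (Γ * Real.log Γ)| + ‖x j 0‖) + 1) ≤ Rb / 8 := by
    rw [h0]; exact hrate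
  have hflat : ∀ σ, Real.sqrt 3 * |Rb * Real.sqrt (Γ * Real.log Γ)| < ‖x j σ‖ → iteratedDeriv 2 (x j) σ = 0 := by
    intro σ hσ
    refine hx.iteratedDeriv_two_eq_zero hℓ j ?_
    have h3 : (Real.sqrt 3 * |Rb * Real.sqrt (Γ * Real.log Γ)|) ^ 2 = 3 * (Rb * Real.sqrt (Γ * Real.log Γ)) ^ 2 := by
      rw [mul_pow, sq_abs, Real.sq_sqrt (by norm_num : (0:ℝ) ≤ 3)]
    rw [← h3]
    exact pow_le_pow_left₀ hR0 hσ.le 2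
  intro τ
  rcases le_total 0 τ with hτ | hτ
  · exact nearStraight_of_conditional_curvature hC2 (ht j) h0' hκ0 hR0 hrate' hRbθ hθ₁h
      (fun T _ htilt => hx.curvature_le_of_tiltOn ht hθd hθd1 hgp hρ hsep hΓ hℓ j hθ₁0 hθ₁A htilt) hflat τ hτ
  · exact nearStraight_of_conditional_curvature_neg hC2 (ht j) h0' hκ0 hR0 hrate' hRbθ hθ₁h
      (fun T _ htilt => hx.curvature_le_of_tiltOn_neg ht hθd hθd1 hgp hρ hsep hΓ hℓ j hθ₁0 hθ₁A htilt) hflat τ hτ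

/-- **CURVATURE OF THE LIA REFERENCE.**  Under the hypotheses of `IsLiaReference.tilt_le`, `‖x_j″ τ‖ ≤ curvCeil` for all `τ`; hence with the
second rate hypothesis `curvCeil · √Γ ≤ Rb/2`: `‖x_j″ τ‖ √Γ ≤ Rb/2`. [folklore] -/
theorem IsLiaReference.curvature_sqrt_le (hx : IsLiaReference Γ Rb p t γ α s₀ x) (ht : ∀ k, ‖t k‖ = 1) (hθd : 0 < θd) (hθd1 : θd ≤ 1)
    (hgp : ∀ j k, j ≠ k → |inner ℝ (t j) (t k)| ≤ 1 - θd) (hρ : 0 < ρ)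
    (hsep : ∀ j k, j ≠ k → ∀ a b : ℝ, ρ ≤ ‖(p j + a • t j) - (p k + b • t k)‖) (hΓ : 0 < Γ) (hℓ : Rb * Real.sqrt (Γ * Real.log Γ) ≠ 0) (j : Fin N) {θ₁ : ℝ}
    (hRbθ : Rb / 8 < θ₁) (hθ₁h : θ₁ ≤ 1 / 2)
    (hθ₁A : ∀ k, k ≠ j → θ₁ ≤ min (Real.sqrt θd / 4) (θd * ρ / (16 * (‖(p j + s₀ j • t j) - (p k + s₀ k • t k)‖ + ρ))))
    (hrate : curvCeil Γ Rb ρ γ α j * (2 * (Real.sqrt 3 * |Rb * Real.sqrt (Γ * Real.log Γ)| + ‖waistPt Γ p t s₀ j‖) + 1) ≤ Rb / 8)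
    (hrate2 : curvCeil Γ Rb ρ γ α j * Real.sqrt Γ ≤ Rb / 2) :
    ∀ τ, ‖iteratedDeriv 2 (x j) τ‖ * Real.sqrt Γ ≤ Rb / 2 := by
  have htilt := hx.tilt_le ht hθd hθd1 hgp hρ hsep hΓ hℓ j hRbθ hθ₁h hθ₁A hrate
  have hθ₁0 : 0 ≤ θ₁ := by
    have := norm_nonneg (deriv (x j) 0 - t j); linarith [htilt 0]
  intro τ
  have hκ : ‖iteratedDeriv 2 (x j) τ‖ ≤ curvCeil Γ Rb ρ γ α j := by
    rcases le_total 0 τ with hτ | hτ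
    · exact hx.curvature_le_of_tiltOn ht hθd hθd1 hgp hρ hsep hΓ hℓ j hθ₁0 hθ₁A (T := τ)
        (fun σ _ => (htilt σ).trans hRbθ.le) τ ⟨hτ, le_rfl⟩
    · exact hx.curvature_le_of_tiltOn_neg ht hθd hθd1 hgp hρ hsep hΓ hℓ j hθ₁0 hθ₁A (T := -τ)
        (fun σ _ => (htilt σ).trans hRbθ.le) τ ⟨by linarith, hτ⟩
  exact (mul_le_mul_of_nonneg_right hκ (Real.sqrt_nonneg Γ)).trans hrate2

/-! ## §3 Separation of two near-straight references -/

/-- **Two-parameter skew bound.**  For unit `t_j, t_k` with `|⟪t_j,t_k⟫| ≤ 1 − θd` (`0 < θd ≤ 1`) and any `v, a, b`: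
`‖v + a t_j − b t_k‖² ≥ θd (a² + b²) − 2‖v‖(|a| + |b|)` (`θd ≤ 1`). [folklore] -/
theorem skew_pair_lower (tj tk v : EuclideanSpace ℝ (Fin 3)) (htj : ‖tj‖ = 1) (htk : ‖tk‖ = 1) (hθd1 : θd ≤ 1)
    (hgp : |inner ℝ tj tk| ≤ 1 - θd) (a b : ℝ) :
    θd * (a ^ 2 + b ^ 2) - 2 * ‖v‖ * (|a| + |b|) ≤ ‖v + a • tj - b • tk‖ ^ 2 := by
  set c := inner ℝ tj tk with hc
  set A := inner ℝ v tj with hA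
  set B := inner ℝ v tk with hB
  have hexp : ‖v + a • tj - b • tk‖ ^ 2 = ‖v‖ ^ 2 + a ^ 2 + b ^ 2 + 2 * a * A - 2 * b * B - 2 * a * b * c := by
    rw [norm_sub_sq_real, norm_add_sq_real, inner_smul_right, inner_smul_right, inner_add_left, inner_smul_left,
      RCLike.conj_to_real, norm_smul, norm_smul, Real.norm_eq_abs, Real.norm_eq_abs, htj, htk, mul_one, mul_one, sq_abs, sq_abs,
      ← hA, ← hB, ← hc]
    ring
  rw [hexp]
  have hA1 : |A| ≤ ‖v‖ := by simpa [hA, htj] using abs_real_inner_le_norm v tj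
  have hB1 : |B| ≤ ‖v‖ := by simpa [hB, htk] using abs_real_inner_le_norm v tk
  have h1 : -(2 * ‖v‖ * |a|) ≤ 2 * a * A := by
    have : |2 * a * A| ≤ 2 * ‖v‖ * |a| := by
      rw [abs_mul, abs_mul, abs_of_pos (by norm_num : (0:ℝ) < 2)]
      nlinarith [abs_nonneg a, abs_nonneg A]
    linarith [neg_abs_le (2 * a * A)]
  have h2 : -(2 * ‖v‖ * |b|) ≤ -(2 * b * B) := by
    have : |2 * b * B| ≤ 2 * ‖v‖ * |b| := by
      rw [abs_mul, abs_mul, abs_of_pos (by norm_num : (0:ℝ) < 2)]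
      nlinarith [abs_nonneg b, abs_nonneg B]
    linarith [le_abs_self (2 * b * B)]
  have h3 : -((1 - θd) * (a ^ 2 + b ^ 2)) ≤ -(2 * a * b * c) := by
    have hab : |2 * a * b * c| ≤ (1 - θd) * (2 * |a| * |b|) := by
      rw [abs_mul, abs_mul, abs_mul, abs_of_pos (by norm_num : (0:ℝ) < 2)]
      have := mul_le_mul_of_nonneg_left hgp (by positivity : 0 ≤ 2 * |a| * |b|)
      linarith
    have hsq : 2 * |a| * |b| ≤ a ^ 2 + b ^ 2 := by nlinarith [sq_abs a, sq_abs b, sq_nonneg (|a| - |b|)]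
    have h1θ : 0 ≤ 1 - θd := by linarith
    nlinarith [le_abs_self (2 * a * b * c), mul_le_mul_of_nonneg_left hsq h1θ]
  nlinarith [norm_nonneg v]

/-- **Global deviation from the datum line.**  If `‖x′ σ − t‖ ≤ θ` for all `σ`, then `‖x τ − (x 0 + τ t)‖ ≤ θ|τ|` for all `τ`. [folklore] -/
theorem norm_sub_line_le_of_nearStraight {x : ℝ → EuclideanSpace ℝ (Fin 3)} (hx : ContDiff ℝ 1 x) {t : EuclideanSpace ℝ (Fin 3)} {θ : ℝ}
    (hθ : ∀ σ, ‖deriv x σ - t‖ ≤ θ) (τ : ℝ) : ‖x τ - (x 0 + τ • t)‖ ≤ θ * |τ| := by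
  have hxd : Differentiable ℝ x := hx.differentiable (by norm_num)
  set f : ℝ → EuclideanSpace ℝ (Fin 3) := fun σ => x σ - σ • t with hf
  have hfd : ∀ σ, HasDerivAt f (deriv x σ - t) σ := fun σ => by
    have h1 : HasDerivAt (fun σ : ℝ => σ • t) ((1:ℝ) • t) σ := (hasDerivAt_id σ).smul_const t
    rw [one_smul] at h1
    exact (hxd σ).hasDerivAt.sub h1
  have h := Convex.norm_image_sub_le_of_norm_deriv_le (f := f) (fun σ _ => (hfd σ).differentiableAt)
    (fun σ _ => by rw [(hfd σ).deriv]; exact hθ σ) convex_univ (mem_univ 0) (mem_univ τ)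
  simp only [hf, zero_smul, sub_zero, Real.norm_eq_abs] at h
  calc ‖x τ - (x 0 + τ • t)‖ = ‖x τ - τ • t - x 0‖ := by congr 1; abel
    _ ≤ θ * |τ| := h

/-- **Separation of near-straight arcs on skew datum lines.**  Two `C¹` arcs from the scaled waists `√Γ q_j, √Γ q_k` of datum lines in general
position (`θd`) with separation `ρ`, each with GLOBAL tilt `≤ θ` against its datum direction, `0 ≤ θ ≤ min (√θd/4) (θd ρ/(16(‖q_j − q_k‖ + ρ)))`,
stay `(ρ/2)√Γ` apart: `(ρ/2)√Γ ≤ ‖x_j τ − x_k σ‖` for all `τ, σ`. [folklore] -/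
theorem sep_of_nearStraight {xj xk : ℝ → EuclideanSpace ℝ (Fin 3)} (hxj : ContDiff ℝ 1 xj) (hxk : ContDiff ℝ 1 xk)
    {qj qk tj tk : EuclideanSpace ℝ (Fin 3)} (htj : ‖tj‖ = 1) (htk : ‖tk‖ = 1) {θd ρ Γ θ : ℝ} (hθd : 0 < θd) (hθd1 : θd ≤ 1)
    (hgp : |inner ℝ tj tk| ≤ 1 - θd) (hρ : 0 < ρ) (hsep : ∀ a b : ℝ, ρ ≤ ‖(qj + a • tj) - (qk + b • tk)‖)
    (h0j : xj 0 = Real.sqrt Γ • qj) (h0k : xk 0 = Real.sqrt Γ • qk) (hθ0 : 0 ≤ θ) (hθ1 : θ ≤ Real.sqrt θd / 4)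
    (hθ2 : θ ≤ θd * ρ / (16 * (‖qj - qk‖ + ρ))) (htiltj : ∀ σ, ‖deriv xj σ - tj‖ ≤ θ) (htiltk : ∀ σ, ‖deriv xk σ - tk‖ ≤ θ)
    (τ σ : ℝ) : ρ / 2 * Real.sqrt Γ ≤ ‖xj τ - xk σ‖ := by
  set s := Real.sqrt Γ with hs
  have hs0 : 0 ≤ s := Real.sqrt_nonneg Γ
  rcases hs0.lt_or_eq with hspos | hszero
  swap
  · rw [← hszero, mul_zero]; exact norm_nonneg _
  set v := qj - qk with hv
  set E₁ := xj τ - (xj 0 + τ • tj) with hE₁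
  set E₂ := xk σ - (xk 0 + σ • tk) with hE₂
  have hE₁le : ‖E₁‖ ≤ θ * |τ| := norm_sub_line_le_of_nearStraight hxj htiltj τ
  have hE₂le : ‖E₂‖ ≤ θ * |σ| := norm_sub_line_le_of_nearStraight hxk htiltk σ
  set a := τ / s with ha
  set b := σ / s with hb
  have hτ : τ = s * a := by rw [ha, mul_div_cancel₀ _ hspos.ne']
  have hσ : σ = s * b := by rw [hb, mul_div_cancel₀ _ hspos.ne']
  have hdec : xj τ - xk σ = s • (v + a • tj - b • tk) + (E₁ - E₂) := by
    have hτ' : τ • tj = s • (a • tj) := by rw [smul_smul, ← hτ]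
    have hσ' : σ • tk = s • (b • tk) := by rw [smul_smul, ← hσ]
    rw [hE₁, hE₂, h0j, h0k, hτ', hσ', hv]
    simp only [smul_sub, smul_add]
    abel
  -- the unperturbed skew distance
  set D := ‖v + a • tj - b • tk‖ with hD
  have hDρ : ρ ≤ D := by
    have := hsep a b
    rwa [show qj + a • tj - (qk + b • tk) = v + a • tj - b • tk by rw [hv]; abel] at this
  have hD2 := skew_pair_lower tj tk v htj htk hθd1 hgp a b
  rw [← hD] at hD2
  set S := |a| + |b| with hS
  have hS0 : 0 ≤ S := by positivity
  -- main inequality in unscaled variables: D − θ S ≥ ρ/2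
  have hmain : ρ / 2 + θ * S ≤ D := by
    by_cases hsmall : θ * S ≤ ρ / 2
    · linarith
    · push Not at hsmall
      have hθpos : 0 < θ := by
        by_contra h; push Not at h
        have : θ = 0 := le_antisymm h hθ0
        rw [this, zero_mul] at hsmall; linarith
      have hden : 0 < 16 * (‖v‖ + ρ) := by positivity
      have h1 : θ * (16 * (‖v‖ + ρ)) ≤ θd * ρ := (le_div_iff₀ hden).1 hθ2
      -- S > ρ/(2θ) ≥ 8(‖v‖+ρ)/θd
      have hSbig : 8 * ‖v‖ ≤ θd * S := by
        have e1 : θ * (16 * (‖v‖ + ρ)) * S ≤ θd * ρ * S := mul_le_mul_of_nonneg_right h1 hS0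
        have e2 : ρ / 2 * (16 * (‖v‖ + ρ)) < θ * S * (16 * (‖v‖ + ρ)) := mul_lt_mul_of_pos_right hsmall hden
        have e3 : ρ * (8 * (‖v‖ + ρ)) < ρ * (θd * S) := by linarith
        have e4 : 8 * (‖v‖ + ρ) < θd * S := lt_of_mul_lt_mul_left e3 hρ.le
        linarith
      have hab : S ^ 2 ≤ 2 * (a ^ 2 + b ^ 2) := by
        rw [hS]; nlinarith [sq_nonneg (|a| - |b|), sq_abs a, sq_abs b]
      have hD2' : θd / 4 * S ^ 2 ≤ D ^ 2 := by
        have p1 := mul_le_mul_of_nonneg_left hab hθd.le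
        have p2 := mul_le_mul_of_nonneg_right hSbig hS0
        rw [hS] at p2 ⊢; rw [hS] at p1
        nlinarith [p1, p2, hD2]
      have hc0 : 0 ≤ Real.sqrt θd := Real.sqrt_nonneg _
      have hc2 : Real.sqrt θd ^ 2 = θd := Real.sq_sqrt hθd.le
      have hDS : Real.sqrt θd / 2 * S ≤ D :=
        (pow_le_pow_iff_left₀ (by positivity) (norm_nonneg _) two_ne_zero).1 (by rw [mul_pow, div_pow, hc2]; linarith)
      have p3 := mul_le_mul_of_nonneg_right hθ1 hS0
      linarith
  -- scale and perturb
  have hpert : s * D - (‖E₁‖ + ‖E₂‖) ≤ ‖xj τ - xk σ‖ := by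
    rw [hdec]
    have h1 : ‖s • (v + a • tj - b • tk)‖ ≤ ‖s • (v + a • tj - b • tk) + (E₁ - E₂)‖ + ‖E₁ - E₂‖ := by
      simpa using norm_sub_le (s • (v + a • tj - b • tk) + (E₁ - E₂)) (E₁ - E₂)
    rw [norm_smul, Real.norm_of_nonneg hs0] at h1
    linarith [norm_sub_le E₁ E₂]
  have hEsum : ‖E₁‖ + ‖E₂‖ ≤ θ * s * S := by
    have h1 : |τ| = s * |a| := by rw [hτ, abs_mul, abs_of_pos hspos]
    have h2 : |σ| = s * |b| := by rw [hσ, abs_mul, abs_of_pos hspos]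
    rw [h1] at hE₁le; rw [h2] at hE₂le
    have h3 : θ * (s * |a|) + θ * (s * |b|) = θ * s * S := by rw [hS]; ring
    linarith
  have h4 := mul_le_mul_of_nonneg_left hmain hs0
  linarith

/-! ## §4 The LIA reference is a sliced reference (under the two rate hypotheses) -/

/-- **THE LIA REFERENCE IS A SLICED REFERENCE** under explicit hypotheses: datum with unit directions in general position (`θd ∈ (0,1]`) and
separation `ρ > 0`; `Γ > 0`, `ℓ = Rb√(Γ log Γ) ≠ 0`; a tilt budget `Rb/8 < θ₁ ≤ ½` below `min (√θd/4) (θd ρ/(16(‖q_j − q_k‖ + ρ)))` for all `j ≠ k`;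
and for every `j` the two rate hypotheses `curvCeil_j · (2(R + ‖√Γ q_j‖) + 1) ≤ Rb/8`, `curvCeil_j · √Γ ≤ Rb/2`.  Then
`SlicedReference Γ ρ Rb p t s₀ x`. [folklore] -/
theorem IsLiaReference.slicedReference (hx : IsLiaReference Γ Rb p t γ α s₀ x) (ht : ∀ k, ‖t k‖ = 1) (hθd : 0 < θd) (hθd1 : θd ≤ 1)
    (hgp : ∀ j k, j ≠ k → |inner ℝ (t j) (t k)| ≤ 1 - θd) (hρ : 0 < ρ)
    (hsep : ∀ j k, j ≠ k → ∀ a b : ℝ, ρ ≤ ‖(p j + a • t j) - (p k + b • t k)‖) (hΓ : 0 < Γ)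
    (hℓ : Rb * Real.sqrt (Γ * Real.log Γ) ≠ 0) {θ₁ : ℝ} (hRbθ : Rb / 8 < θ₁) (hθ₁h : θ₁ ≤ 1 / 2)
    (hθ₁A : ∀ j k, k ≠ j → θ₁ ≤ min (Real.sqrt θd / 4) (θd * ρ / (16 * (‖(p j + s₀ j • t j) - (p k + s₀ k • t k)‖ + ρ))))
    (hrate : ∀ j, curvCeil Γ Rb ρ γ α j * (2 * (Real.sqrt 3 * |Rb * Real.sqrt (Γ * Real.log Γ)| + ‖waistPt Γ p t s₀ j‖) + 1) ≤ Rb / 8)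
    (hrate2 : ∀ j, curvCeil Γ Rb ρ γ α j * Real.sqrt Γ ≤ Rb / 2) :
    SlicedReference Γ ρ Rb p t s₀ x := by
  have htilt : ∀ j τ, ‖deriv (x j) τ - t j‖ ≤ Rb / 8 := fun j =>
    hx.tilt_le ht hθd hθd1 hgp hρ hsep hΓ hℓ j hRbθ hθ₁h (hθ₁A j) (hrate j)
  refine ⟨fun j => ⟨(hx j).1, (hx j).2.1, (hx j).2.2.1⟩, htilt, fun j => hx.curvature_sqrt_le ht hθd hθd1 hgp hρ hsep hΓ hℓ j hRbθ
    hθ₁h (hθ₁A j) (hrate j) (hrate2 j), fun j k hjk τ σ => ?_⟩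
  have hRb0 : 0 ≤ Rb / 8 := (norm_nonneg _).trans (htilt j 0)
  have hA := hθ₁A j k hjk.symm
  exact sep_of_nearStraight ((hx j).1.of_le (by norm_num)) ((hx k).1.of_le (by norm_num)) (ht j) (ht k) hθd hθd1 (hgp j k hjk) hρ
    (fun a b => datum_sep_waist (s₀ := s₀) hsep hjk a b) ((hx j).2.2.1.trans (waistPt_eq Γ p t s₀ j))
    ((hx k).2.2.1.trans (waistPt_eq Γ p t s₀ k)) hRb0 (hRbθ.le.trans (le_min_iff.1 hA).1) (hRbθ.le.trans (le_min_iff.1 hA).2)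
    (htilt j) (htilt k) τ σ

end Summit.NavierStokesRegularity.NavierStokesRegularity.Theorems.SkeletonJ1RFrame

end
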